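import Literature.MathematicalPhysics.QuantumLattice.DWaveSourceProofs
import Literature.MathematicalPhysics.QuantumLattice.LiebFluxPhaseProofs
import Literature.MathematicalPhysics.QuantumLattice.SectorSpectrum
import Literature.MathematicalPhysics.QuantumLattice.FermionOperatorsProofs
import Literature.MathematicalPhysics.QuantumLattice.FermionLiebRobinson

/-!
# Crux `TwSeededEnsembleEquivalence` (stmt-HubbardSuperconductivity-1698), line `exposed-density-duality` — stub `stub_seedCommutator`

Seed commutator bound: `‖[Δ_dᴴΔ_d, c_k]‖, ‖[Δ_dᴴΔ_d, c_k†]‖ ≤ C·L²` uniformly in `L` and the orbital `k`.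

Proof (graded locality, Bratteli–Robinson II §5.2.2, as formalised in
`FermionTraceFactorization.lean` / `FermionLiebRobinson.lean`): `[ΔᴴΔ, c] = Δᴴ[Δ, c] + [Δᴴ, c]Δ`, so
`‖[ΔᴴΔ, c]‖ ≤ ‖Δ‖ (‖[Δ, c]‖ + ‖[Δᴴ, c]‖)` with `‖Δ‖ ≤ K L²`, `K = 2 Σ_e |d(e)/√2|`
(`norm_pairField_le`). Now `Δ = Σ_y P_y` (resp. `Δᴴ = Σ_y P_yᴴ`) with `P_y = localPair d L y` an EVEN
element of the CAR algebra of the `≤ 5` sites `y + e`, `e ∈ {0, ±e₁, ±e₂}`, of norm `≤ K`, while a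
single fermion operator `c ∈ {c_k, c_k†}` lies in the CAR algebra of the orbital `k`; even elements
commute with the CAR algebra of a disjoint region (`commute_of_mem_carEvenSubalgebra`), so
`[P_y, c] = 0` unless the site of `k` is one of the `y + e`, i.e. for at most `5` values of `y`, each
contributing at most `2K‖c‖ ≤ 2K`. Hence `‖[ΔᴴΔ, c]‖ ≤ K L² · 4 · 5 · K`, and `C = 4 · 5 · K²` works
(with `5` kept as `#(insert 0 unitSteps)`).

As in `Theorems/WeakCouplingBCSWcbcsBcsConstructionDoubleCommutatorBound.lean`, the torus-level
lemma is stated for an ARBITRARY `DecidableEq (FermionTorus 2 L)` instance (on which the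
`L²`-operator norm depends syntactically) and its proof substitutes the generic
`LinearOrder.toDecidableEq` carried by the CAR-algebra lemmas.
-/

namespace Summit.HubbardSuperconductivity.HubbardSuperconductivity.Theorems.TwSeededEnsembleEquivalence.ExposedDensity

open Matrix Filter Topology Literature.MathematicalPhysics.QuantumLattice
open scoped ComplexOrder Matrix.Norms.L2Operator

noncomputable section

section SeedCommutatorHelpers

open Literature.Probability.LatticeModels Literature.Barriers.HubbardSuperconductivity

variable {Λ : Type*} [LinearOrder Λ] [Fintype Λ]

/-- `c_i c_j` is an even element of the CAR algebra of any orbital set containing `i, j`.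
[folklore] -/
private theorem sc_annihilation_mul_annihilation_mem_carEvenSubalgebra {ι : Type*} [LinearOrder ι]
    [Fintype ι] {S : Finset ι} {i j : ι} (hi : i ∈ S) (hj : j ∈ S) :
    annihilation i * annihilation j ∈ carEvenSubalgebra S :=
  -- adapted from `dc_annihilation_mul_annihilation_mem_carEvenSubalgebra`
  -- (Theorems/WeakCouplingBCSWcbcsBcsConstructionDoubleCommutatorBound.lean)
  Algebra.subset_adjoin ⟨(i, false), (j, false), hi, hj, rfl⟩

/-- `c†_i c†_j` is an even element of the CAR algebra of any orbital set containing `i, j`.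
[folklore] -/
private theorem sc_creation_mul_creation_mem_carEvenSubalgebra {ι : Type*} [LinearOrder ι]
    [Fintype ι] {S : Finset ι} {i j : ι} (hi : i ∈ S) (hj : j ∈ S) :
    creation i * creation j ∈ carEvenSubalgebra S :=
  Algebra.subset_adjoin ⟨(i, true), (j, true), hi, hj, rfl⟩

/-- The singlet bond pair `b_{uv} = c_{u↑}c_{v↓} - c_{u↓}c_{v↑}` is an even element of the CAR
algebra of any set of sites containing `u, v`. [folklore] -/
private theorem sc_bondPair_mem_carEvenSubalgebra {W : Finset Λ} {u v : Λ} (hu : u ∈ W) (hv : v ∈ W) :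
    bondPair u v ∈ carEvenSubalgebra (orbSet W) :=
  -- adapted from `dc_bondPair_mem_carEvenSubalgebra` (same file as above)
  Subalgebra.sub_mem _
    (sc_annihilation_mul_annihilation_mem_carEvenSubalgebra (orb_mem_orbSet hu 0) (orb_mem_orbSet hv 1))
    (sc_annihilation_mul_annihilation_mem_carEvenSubalgebra (orb_mem_orbSet hu 1) (orb_mem_orbSet hv 0))

/-- … and so is its adjoint `(b_{uv})† = c†_{v↓}c†_{u↑} - c†_{v↑}c†_{u↓}`. [folklore] -/
private theorem sc_bondPair_conjTranspose_mem_carEvenSubalgebra {W : Finset Λ} {u v : Λ} (hu : u ∈ W)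
    (hv : v ∈ W) :
    (bondPair u v)ᴴ ∈ carEvenSubalgebra (orbSet W) := by
  rw [bondPair_conjTranspose]
  exact Subalgebra.sub_mem _
    (sc_creation_mul_creation_mem_carEvenSubalgebra (orb_mem_orbSet hv 1) (orb_mem_orbSet hu 0))
    (sc_creation_mul_creation_mem_carEvenSubalgebra (orb_mem_orbSet hv 0) (orb_mem_orbSet hu 1))

/-- A weighted sum of bond pairs `Σ_e c_e b_{u, v_e}` is an even element of the CAR algebra of any
set of sites containing `u` and all `v_e` (generic form of the locality of `P_x`). [folklore] -/
private theorem sc_sum_smul_bondPair_mem {τ : Type*} {W : Finset Λ} (S : Finset τ) (c : τ → ℂ)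
    {u : Λ} (v : τ → Λ) (hu : u ∈ W) (hv : ∀ e ∈ S, v e ∈ W) :
    (∑ e ∈ S, c e • bondPair u (v e)) ∈ carEvenSubalgebra (orbSet W) :=
  -- adapted from `dc_sum_smul_bondPair_add_conjTranspose_mem` (same file as above)
  Subalgebra.sum_mem _ fun e he =>
    Subalgebra.smul_mem _ (sc_bondPair_mem_carEvenSubalgebra hu (hv e he)) _

/-- … and so is its adjoint `Σ_e c̄_e (b_{u, v_e})†` (locality of `P_x†`). [folklore] -/
private theorem sc_sum_smul_bondPair_conjTranspose_mem {τ : Type*} {W : Finset Λ} (S : Finset τ)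
    (c : τ → ℂ) {u : Λ} (v : τ → Λ) (hu : u ∈ W) (hv : ∀ e ∈ S, v e ∈ W) :
    (∑ e ∈ S, c e • bondPair u (v e))ᴴ ∈ carEvenSubalgebra (orbSet W) := by
  rw [conjTranspose_sum]
  refine Subalgebra.sum_mem _ fun e he => ?_
  rw [conjTranspose_smul]
  exact Subalgebra.smul_mem _ (sc_bondPair_conjTranspose_mem_carEvenSubalgebra hu (hv e he)) _

/-- **Graded locality for a sum of even local observables against a single-orbital operator.**
If every `q_y` is even and localised on the sites `V y`, `‖q_y‖ ≤ M`, `c` lies in the CAR algebra of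
the single orbital `k`, and the site of `k` belongs to `V y` only for `y ∈ T`, then
`‖[Σ_y q_y, c]‖ ≤ |T| · 2M‖c‖` (the other commutators vanish, Bratteli–Robinson II §5.2.2).
[folklore] -/
private theorem sc_norm_commutator_sum_even_local_le {κ : Type*} [Fintype κ] (V : κ → Finset Λ)
    (q : κ → Matrix (Finset (Orb Λ)) (Finset (Orb Λ)) ℂ)
    (hq : ∀ y, q y ∈ carEvenSubalgebra (orbSet (V y))) {M : ℝ} (hM : ∀ y, ‖q y‖ ≤ M)
    {k : Orb Λ} {c : Matrix (Finset (Orb Λ)) (Finset (Orb Λ)) ℂ}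
    (hc : c ∈ carSubalgebra ({k} : Finset (Orb Λ))) (T : Finset κ)
    (hT : ∀ y, (ofLex k).1 ∈ V y → y ∈ T) :
    ‖(∑ y, q y) * c - c * ∑ y, q y‖ ≤ T.card * (2 * M * ‖c‖) := by
  rw [finset_sum_commutator]
  have hvanish : ∀ y, y ∉ T → q y * c - c * q y = 0 := fun y hy =>
    sub_eq_zero.mpr (commute_of_mem_carEvenSubalgebra (hq y) hc
      (Finset.disjoint_singleton_right.2 fun hk => hy (hT y (mem_orbSet.1 hk)))).eq
  rw [← Finset.sum_subset (Finset.subset_univ T) fun y _ hy => hvanish y hy]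
  calc ‖∑ y ∈ T, (q y * c - c * q y)‖ ≤ ∑ y ∈ T, ‖q y * c - c * q y‖ := norm_sum_le _ _
    _ ≤ ∑ _y ∈ T, 2 * M * ‖c‖ := Finset.sum_le_sum fun y _ => by
        calc ‖q y * c - c * q y‖ ≤ ‖q y * c‖ + ‖c * q y‖ := norm_sub_le _ _
          _ ≤ ‖q y‖ * ‖c‖ + ‖c‖ * ‖q y‖ := add_le_add (norm_mul_le _ _) (norm_mul_le _ _)
          _ = 2 * ‖q y‖ * ‖c‖ := by ring
          _ ≤ 2 * M * ‖c‖ := by gcongr; exact hM y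
    _ = T.card * (2 * M * ‖c‖) := by rw [Finset.sum_const, nsmul_eq_mul]

/-- **The seed commutator bound for one fermion operator.** For every form factor `g` and every
orbital `k`, with `c ∈ {c_k, c_k†}`, `‖[Δ_gᴴ Δ_g, c]‖ ≤ 4 s K² L²` where `s = #{0, ±e₁, ±e₂}`,
`K = 2 Σ_e |g e/√2|`: `[ΔᴴΔ, c] = Δᴴ[Δ, c] + [Δᴴ, c]Δ`, `‖Δ‖ ≤ K L²`, and `[Δ, c]`, `[Δᴴ, c]` have
norm `≤ s · 2K` by graded locality (only the `≤ s` local pairs touching the site of `k` fail to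
commute with `c`, and `‖c‖ ≤ 1`). Stated for an arbitrary `DecidableEq (FermionTorus 2 L)` instance;
the proof substitutes `LinearOrder.toDecidableEq`. [folklore] -/
private theorem sc_norm_commutator_seed_le (g : Site 2 → ℝ) (L : ℕ) [NeZero L]
    [inst : DecidableEq (FermionTorus 2 L)] (k : Orb (FermionTorus 2 L)) :
    ‖(pairField g L)ᴴ * pairField g L * annihilation k -
          annihilation k * ((pairField g L)ᴴ * pairField g L)‖ ≤
        4 * (insert (0 : Site 2) unitSteps).card *
          (2 * ∑ e ∈ insert (0 : Site 2) unitSteps, |g e / Real.sqrt 2|) ^ 2 * (L : ℝ) ^ 2 ∧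
      ‖(pairField g L)ᴴ * pairField g L * creation k -
          creation k * ((pairField g L)ᴴ * pairField g L)‖ ≤
        4 * (insert (0 : Site 2) unitSteps).card *
          (2 * ∑ e ∈ insert (0 : Site 2) unitSteps, |g e / Real.sqrt 2|) ^ 2 * (L : ℝ) ^ 2 := by
  have hinst : inst = LinearOrder.toDecidableEq := Subsingleton.elim _ _
  subst hinst
  letI hdec : DecidableEq (FermionTorus 2 L) := LinearOrder.toDecidableEq
  -- reduce to a single fermion operator `c` in the CAR algebra of `k` with `‖c‖ ≤ 1`
  suffices key : ∀ c : Matrix (Finset (Orb (FermionTorus 2 L))) (Finset (Orb (FermionTorus 2 L))) ℂ,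
      c ∈ carSubalgebra ({k} : Finset (Orb (FermionTorus 2 L))) → ‖c‖ ≤ 1 →
      ‖(pairField g L)ᴴ * pairField g L * c - c * ((pairField g L)ᴴ * pairField g L)‖ ≤
        4 * (insert (0 : Site 2) unitSteps).card *
          (2 * ∑ e ∈ insert (0 : Site 2) unitSteps, |g e / Real.sqrt 2|) ^ 2 * (L : ℝ) ^ 2 by
    exact ⟨key _ (annihilation_mem_carSubalgebra (Finset.mem_singleton_self k))
        (norm_annihilation_le_one k),
      key _ (creation_mem_carSubalgebra (Finset.mem_singleton_self k)) (norm_creation_le_one k)⟩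
  intro c hc hc1
  set S : Finset (Site 2) := insert 0 unitSteps
  set K : ℝ := 2 * ∑ e ∈ S, |g e / Real.sqrt 2|
  have hK0 : 0 ≤ K := by positivity
  -- the supports of the local pairs
  set V : TorusSite 2 L → Finset (FermionTorus 2 L) :=
    fun y => S.image fun e => FermionTorus.ofTorusSite (y + Torus.proj L e)
  have h0 : Torus.proj L (0 : Site 2) = 0 := funext fun i => by simp
  have hy : ∀ y : TorusSite 2 L, FermionTorus.ofTorusSite y ∈ V y := fun y =>
    Finset.mem_image.2 ⟨0, Finset.mem_insert_self _ _, by rw [h0, add_zero]⟩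
  have he : ∀ (y : TorusSite 2 L), ∀ e ∈ S, FermionTorus.ofTorusSite (y + Torus.proj L e) ∈ V y :=
    fun y e he => Finset.mem_image_of_mem _ he
  have hq : ∀ y, localPair g L y ∈ carEvenSubalgebra (orbSet (V y)) := fun y => by
    rw [localPair_eq_sum_bondPair]
    exact sc_sum_smul_bondPair_mem _ _ _ (hy y) (he y)
  have hq' : ∀ y, (localPair g L y)ᴴ ∈ carEvenSubalgebra (orbSet (V y)) := fun y => by
    rw [localPair_eq_sum_bondPair]
    exact sc_sum_smul_bondPair_conjTranspose_mem _ _ _ (hy y) (he y)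
  have hM : ∀ y, ‖localPair g L y‖ ≤ K := norm_localPair_le g L
  have hM' : ∀ y, ‖(localPair g L y)ᴴ‖ ≤ K := fun y => by
    rw [l2_opNorm_conjTranspose]; exact hM y
  -- counting: the site of `k` lies in `V y` only for `y = site(k) - e`, `e ∈ S`
  set T : Finset (TorusSite 2 L) :=
    S.image fun e => FermionTorus.toTorusSite (ofLex k).1 - Torus.proj L e
  have hT : ∀ y, (ofLex k).1 ∈ V y → y ∈ T := fun y hyV => by
    obtain ⟨e, he', hwe⟩ := Finset.mem_image.1 hyV
    refine Finset.mem_image.2 ⟨e, he', ?_⟩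
    rw [← hwe, FermionTorus.toTorusSite_ofTorusSite, add_sub_cancel_right]
  have hTcard : (T.card : ℝ) ≤ S.card := by exact_mod_cast Finset.card_image_le
  -- the two single commutators
  have h1 : ‖pairField g L * c - c * pairField g L‖ ≤ S.card * (2 * K) := by
    have h := sc_norm_commutator_sum_even_local_le V (fun y => localPair g L y) hq hM hc T hT
    calc ‖pairField g L * c - c * pairField g L‖ ≤ T.card * (2 * K * ‖c‖) := h
      _ ≤ S.card * (2 * K * 1) := by gcongr
      _ = S.card * (2 * K) := by ring
  have h2 : ‖(pairField g L)ᴴ * c - c * (pairField g L)ᴴ‖ ≤ S.card * (2 * K) := by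
    have hsum : (pairField g L)ᴴ = ∑ y, (localPair g L y)ᴴ := by
      rw [pairField, conjTranspose_sum]
    have h := sc_norm_commutator_sum_even_local_le V (fun y => (localPair g L y)ᴴ) hq' hM' hc T hT
    rw [hsum]
    calc ‖(∑ y, (localPair g L y)ᴴ) * c - c * ∑ y, (localPair g L y)ᴴ‖
        ≤ T.card * (2 * K * ‖c‖) := h
      _ ≤ S.card * (2 * K * 1) := by gcongr
      _ = S.card * (2 * K) := by ring
  -- assemble
  have hΔ : ‖pairField g L‖ ≤ K * (L : ℝ) ^ 2 := norm_pairField_le g L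
  have hid : (pairField g L)ᴴ * pairField g L * c - c * ((pairField g L)ᴴ * pairField g L) =
      (pairField g L)ᴴ * (pairField g L * c - c * pairField g L) +
        ((pairField g L)ᴴ * c - c * (pairField g L)ᴴ) * pairField g L := by
    simp only [Matrix.mul_sub, Matrix.sub_mul, Matrix.mul_assoc]
    abel
  rw [hid]
  calc ‖(pairField g L)ᴴ * (pairField g L * c - c * pairField g L) +
          ((pairField g L)ᴴ * c - c * (pairField g L)ᴴ) * pairField g L‖
      ≤ ‖(pairField g L)ᴴ * (pairField g L * c - c * pairField g L)‖ +
          ‖((pairField g L)ᴴ * c - c * (pairField g L)ᴴ) * pairField g L‖ := norm_add_le _ _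
    _ ≤ ‖(pairField g L)ᴴ‖ * ‖pairField g L * c - c * pairField g L‖ +
          ‖(pairField g L)ᴴ * c - c * (pairField g L)ᴴ‖ * ‖pairField g L‖ :=
        add_le_add (norm_mul_le _ _) (norm_mul_le _ _)
    _ = ‖pairField g L‖ * (‖pairField g L * c - c * pairField g L‖ +
          ‖(pairField g L)ᴴ * c - c * (pairField g L)ᴴ‖) := by
        rw [l2_opNorm_conjTranspose]; ring
    _ ≤ (K * (L : ℝ) ^ 2) * (S.card * (2 * K) + S.card * (2 * K)) :=
        mul_le_mul hΔ (add_le_add h1 h2) (by positivity) (by positivity)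
    _ = 4 * S.card * K ^ 2 * (L : ℝ) ^ 2 := by ring

end SeedCommutatorHelpers

/-- Seed commutator bound: `‖[Δ_dᴴΔ_d, c_k]‖, ‖[Δ_dᴴΔ_d, c_k†]‖ ≤ C·L²` uniformly in `L` and the orbital `k` (`[Δ_dᴴΔ_d, c_k] = [Δ_dᴴ, c_k]Δ_d` since `[Δ_d, c_k] = 0`; `[Δ_dᴴ, c_k]` is a sum of ≤ 20 single creation operators with coefficients `|d(e)|/√2`; `‖Δ_d‖ ≤ 4√2 L²` by `norm_pairField_le`). -/
theorem stub_seedCommutator :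
    ∃ C : ℝ, 0 ≤ C ∧ ∀ (L : ℕ) [NeZero L] (k : Orb (FermionTorus 2 L)),
      ‖(pairField dWaveFormFactor L)ᴴ * pairField dWaveFormFactor L * annihilation k -
          annihilation k * ((pairField dWaveFormFactor L)ᴴ * pairField dWaveFormFactor L)‖ ≤
        C * (L : ℝ) ^ 2 ∧
      ‖(pairField dWaveFormFactor L)ᴴ * pairField dWaveFormFactor L * creation k -
          creation k * ((pairField dWaveFormFactor L)ᴴ * pairField dWaveFormFactor L)‖ ≤
        C * (L : ℝ) ^ 2 :=
  ⟨4 * (insert (0 : Literature.Probability.LatticeModels.Site 2) unitSteps).card *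
      (2 * ∑ e ∈ insert (0 : Literature.Probability.LatticeModels.Site 2) unitSteps,
        |dWaveFormFactor e / Real.sqrt 2|) ^ 2,
    by positivity, fun L _ k => sc_norm_commutator_seed_le dWaveFormFactor L k⟩

end

end Summit.HubbardSuperconductivity.HubbardSuperconductivity.Theorems.TwSeededEnsembleEquivalence.ExposedDensity
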